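import Summits.Schanuel.Schanuel.Theses.DiophantineDichotomy

/-!
# Route `DiophantineDichotomy`, support item `TypedImpliesEv`: the all-heights measure implies
the eventual one

`Summit.Schanuel.Schanuel.Theses.DiophantineDichotomy.TypedImpliesEv` (item stmt-Schanuel-14974)
is the implication

`KhovanskiiApproxType → KhovanskiiApproxTypeEv`,

where, in the route file,

* `KhovanskiiApproxType` (item stmt-Schanuel-6116) asserts, at every free Khovanskii point
  `θ = (s, e^s)`, `n ≥ 2`, the simultaneous approximation measure
  `exp (-(C (d ^ a log H + d ^ b))) ≤ ‖γ - θ‖` for ALL heights `H`, and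
* `KhovanskiiApproxTypeEv` (crux stmt-Schanuel-14972) asserts the same measure only EVENTUALLY in
  the height: for every degree budget `d` there is a threshold `H₀` past which it holds.

So the implication is bookkeeping: keep the same exponents `a, b, C` and take the threshold
`H₀ := 0` for every `d`; the extra hypothesis `H₀ ≤ H` is discarded.

## Contents

* `typedImpliesEv_proof : TypedImpliesEv` — the route decl, verbatim.

Nothing else is proved here; in particular neither measure is established.
-/

-- `Summit.<Summit>.<Problem>` is the mandated summit-side namespace (CONVENTIONS §2); for the
-- single-conjunct summit `Schanuel` the two coincide, so the duplicate `Schanuel.Schanuel` is deliberate.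
set_option linter.dupNamespace false

namespace Summit.Schanuel.Schanuel.Theorems

/-- **The all-heights Khovanskii approximation type implies the eventual one** (route decl
`Summit.Schanuel.Schanuel.Theses.DiophantineDichotomy.TypedImpliesEv`, item stmt-Schanuel-14974):
`KhovanskiiApproxType → KhovanskiiApproxTypeEv`. Pure logic: the exponents `a, b, C` supplied by
`KhovanskiiApproxType` at the free Khovanskii point `(s, e^s)` work verbatim for the eventual
statement with threshold `H₀ := 0` for every degree budget `d` (the hypothesis `H₀ ≤ H` is simply
not used). [folklore] -/
theorem typedImpliesEv_proof :
    Summit.Schanuel.Schanuel.Theses.DiophantineDichotomy.TypedImpliesEv := by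
  unfold Summit.Schanuel.Schanuel.Theses.DiophantineDichotomy.TypedImpliesEv
    Summit.Schanuel.Schanuel.Theses.DiophantineDichotomy.KhovanskiiApproxType
    Summit.Schanuel.Schanuel.Theses.DiophantineDichotomy.KhovanskiiApproxTypeEv
  intro hAT n s hn hli hg
  obtain ⟨a, b, C, ha, hC, h⟩ := hAT n s hn hli hg
  exact ⟨a, b, C, ha, hC, fun d => ⟨0, fun H γ _ hdeg hroot => h d H γ hdeg hroot⟩⟩

end Summit.Schanuel.Schanuel.Theorems
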